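import Literature.MathematicalPhysics.QuantumFieldTheory.Balaban1983to89.B6Ineq2140GradGDivKLevelV1
import Literature.MathematicalPhysics.QuantumFieldTheory.Balaban1983to89.B6Ineq2140GradKLevelCensusV1
import Literature.MathematicalPhysics.QuantumFieldTheory.Balaban1983to89.B6Prop26DivLegKLevelV1
import Literature.MathematicalPhysics.QuantumFieldTheory.Balaban1983to89.B6Cor28KLevelV1
import HarnessLib

/-!
# `Balaban1983to89.B6Ineq2140GradGDivCensusKLevelV1` — T. Bałaban, *Propagators and renormalization transformations for lattice gauge theories. II*,
Commun. Math. Phys. **96** (1984) 223–250 [Balaban1984PropagatorsII], Prop. 2.6 (2.140)₄ p. 247: **`‖h_□ ∇G(𝔅)∇* h_□′‖ ≤ C(M)e^{−δ₂ dist(□,□′)}`,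
HYPOTHESIS-FREE ON THE GENUINE k-LEVEL CENSUS — the displayed slot `hl3` of `B6Prop26PrintedStage2KLevelV1.prop26Printed_kLevel_of_slots5`,
VERBATIM** (file F4e of the interior-energy route; cell pub-ymgap, seat dag-p1, `HOME/pub-ymgap-dag-p1/HL3-PLAN.md`; lit-balaban GAPS G-B6-2140-456,
«(2.140)₄ at k levels»).  The constants `(δ, A, M₂, N₁)` are assembled from p22's hypothesis-free (2.140)₂ (`ineq2140_gradT_kLevel_census_of_h3` fed
with p38's `prop26_2136_div_kLevel_census`), the `ℓ²` majorant of `∂(1−R)∂*` (`B6QFormDgL2KLevelV1.hasL2Majorant_Dg_V1`), the torus (2.61)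
(`lemma21_torus` through `B6CutoffSupportKLevelV1.ineq261_geomT`, threshold `B6Cor28KLevelV1.theta_threshold`) and the per-member bound
`B6Ineq2140GradGDivKLevelV1.l2n_blockPiece_DGDa_le`.
HONEST FRAMING (programme rule): statement-level skeleton of published theorems with citation tags; proofs where landed; nothing here is a claim about
the Yang–Mills mass gap.  Finite-lattice bookkeeping assembling named inputs of seats p21/p22/p38/r03 and of this seat; no estimate of print beyond
those inputs is asserted; THEOREMS ONLY; a T1 landing, NOT a node discharge; nothing continuum ∕ mass-gap ∕ Clay.
WHAT IS PROVED (0 sorry; standard axioms): **`ineq2140_gradGDiv_kLevel_census`** — the slot `hl3` of `prop26Printed_kLevel_of_slots5` for every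
`0 < b₀ ≤ b₁`.  Seat `pub-ymgap-dag-p1` (prover), 2026-08-25.  NOT summit progress.
-/

open scoped BigOperators

noncomputable section

namespace Literature.MathematicalPhysics.QuantumFieldTheory.Balaban1983to89.B6Ineq2140GradGDivCensusKLevelV1

open Finset
open LatticeFieldCalculus B6SectAOperatorsV1 B6SectAVectorModelV1
open B6MultiLevelBoxOperator (N0)
open B6MultiLevelTorusOperator (TDomains)
open B6Geom246MultiLevelBox (bset)
open B6Geom246MultiLevelTorus (geomT triangle_refl_nonneg_T)
open B6GlobalChartV1 (PV domT blkV1)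
open B6Cover236MultiLevelBlocks (cubes)
open B6CubeWindowV1 (Placed GlobalBand)
open B6Lemma21Repaired (Ineq261With)
open B6Ineq261LevelGap (K261)
open B6RandomWalk (blockPiece)
open B6RandomWalkL2 (l2n l2n_nonneg HasL2Majorant sum_sq_cut_apply_le_of_hasL2Majorant)
open B6Ineq2133TwoScaleV1 (onFun)
open B6GradLegKLevelV1 (DV)
open B6LapLegKLevelV1 (DVa)
open B6IMSTermsV1 (hasL2Majorant_of_sigma)
open B6CutoffSupportKLevelV1 (ineq261_geomT)
open B6QFormDgL2KLevelV1 (hasL2Majorant_Dg_V1)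
open B6Ineq2140GradGDivKLevelV1 (l2n_blockPiece_DGDa_le)
open B6Ineq2140GradKLevelCensusV1 (ineq2140_gradT_kLevel_census_of_h3)
open B6Prop26DivLegKLevelV1 (prop26_2136_div_kLevel_census)
open B6Cor28KLevelV1 (theta_threshold)

variable {d ℓ : ℕ} {hd : 1 ≤ d + 1} {hL : Odd (ℓ + 1) ∧ 1 < ℓ + 1} {b₀ b₁ : ℝ}

/-- **(2.140)₄ HYPOTHESIS-FREE ON THE GENUINE k-LEVEL CENSUS** — the displayed slot `hl3` of
`B6Prop26PrintedStage2KLevelV1.prop26Printed_kLevel_of_slots5`, verbatim: for every `0 < b₀ ≤ b₁` there are `δ > 0`, `A ≥ 0`, `M₂ > 0`, `N₁` with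
`‖ζ·(∇_ν G(𝔅)∇*_μ J)‖² ≤ (A e^{−δ d_T(y,y′)} s)²‖J‖²` for every member of the census (`M = L·M_h ≥ M₂`, `R·M ≥ N₁ + 1`), every cut-off `|ζ| ≤ s`
supported in `Δ(y)` and every `J` supported in `Δ(y′)`.
[cite: Balaban1984PropagatorsII, Prop. 2.6 (2.140) p.247] -/
theorem ineq2140_gradGDiv_kLevel_census (hb₀ : 0 < b₀) (hb₁ : b₀ ≤ b₁) :
    ∃ (δ A M₂ : ℝ) (N₁ : ℕ), 0 < δ ∧ 0 ≤ A ∧ 0 < M₂ ∧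
      ∀ (m K : ℕ) {Mh k R : ℕ} {P' : Fin (d + 1) → ℕ}
        (hN : ∀ μ, N0 ℓ Mh k P' μ = (PV d ℓ m K hd hL).sitesPerDir 0) (D : TDomains d ℓ Mh k P' R) (hk : k ≤ m + K) (_ : 2 ≤ k)
        {a : ℕ} (_ : Mh = (ℓ + 1) ^ a) (_ : 8 ≤ Mh) (_ : 2 * (ℓ + 1) ^ 2 ≤ R) (_ : ∀ μ, 5 ≤ P' μ) (_ : 4 ≤ ℓ)
        (_ : ∀ c : ↥(cubes D.toDomains), Placed ℓ k P' c.1) (_ : M₂ ≤ ((ℓ : ℝ) + 1) * Mh) (_ : N₁ + 1 ≤ R * ((ℓ + 1) * Mh))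
        {cf : ℝ} (hcf : cf ≠ 0) {w : BondIdx (domT hN D hk) → ℝ} (hw : ∀ i, 0 < w i) (_ : GlobalBand b₀ b₁ cf w)
        (ν μ : Fin (d + 1)) (y y' : (geomT D).Site) (ζ J : PBond (PV d ℓ m K hd hL) 0 → ℝ) {s : ℝ} (_ : 0 ≤ s)
        (_ : ∀ x, blkV1 hN D x ≠ y → ζ x = 0) (_ : ∀ x, |ζ x| ≤ s) (_ : ∀ x, blkV1 hN D x ≠ y' → J x = 0),
        ∑ x, (ζ x * (DV ν cf ∘ₗ onFun (GE (domT hN D hk) hcf hw) ∘ₗ DVa μ cf) J x) ^ 2 ≤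
          (A * Real.exp (-(δ * (geomT D).dist y y')) * s) ^ 2 * ∑ x, J x ^ 2 := by
  classical
  -- (2.140)₂ for `G∇*_μ`, hypothesis-free (p22 ∘ p38)
  obtain ⟨δH, A₂, M₂h, N₁h, hδH, hA₂, hM₂h, hH⟩ :=
    ineq2140_gradT_kLevel_census_of_h3 (d := d) (ℓ := ℓ) (hd := hd) (hL := hL) hb₀ hb₁
      (prop26_2136_div_kLevel_census d ℓ hd hL hb₀ hb₁)
  -- (2.88) in `ℓ²` form
  obtain ⟨M₃, δP, C, hM₃, hδP, hC, hS⟩ := hasL2Majorant_Dg_V1 d ℓ hd hL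
  -- rates and the (2.61) threshold
  set δe : ℝ := min δP δH / 2 with hδe
  have hδe0 : 0 < δe := by rw [hδe]; exact div_pos (lt_min hδP hδH) two_pos
  have hδeP : δe + δe ≤ δP := by rw [hδe]; linarith [min_le_left δP δH]
  have hδeH : δe ≤ δH := by rw [hδe]; linarith [min_le_right δP δH, (lt_min hδP hδH).le]
  obtain ⟨hN₀, hθ⟩ := theta_threshold d ℓ (δ := 32 * δe) (by positivity)
  set N₀ : ℕ := ⌈64 * ((d : ℝ) + 1) * ((ℓ : ℝ) + 1) / (32 * δe)⌉₊ + 1 with hN₀def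
  have hθ' : Real.exp (-δe) * ((ℓ : ℝ) + 1) ^ ((2 * (d + 1 : ℕ) : ℝ) / N₀) < 1 := by
    have h32 : (1 : ℝ) / 16 * (32 * δe / 2) = δe := by ring
    rw [h32] at hθ; exact hθ
  set Kc : ℝ := K261 N₀ (d + 1) ((ℓ : ℝ) + 1) 1 δe with hKc
  -- the constants
  set r₂ : ℝ := 4 * ((d : ℝ) + 1) with hr₂
  set P₁ : ℝ := Real.exp (δe * (r₂ + 1)) * Kc with hP₁
  set M₁ : ℝ := A₂ * ((ℓ : ℝ) + 1) * Real.exp (δH * (r₂ + 1)) with hM₁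
  set Bsum : ℝ := Real.exp (δe * (r₂ + 1)) * Real.sqrt P₁ * M₁ * ((ℓ : ℝ) + 1) +
      Real.exp (δe * r₂) * Kc * (A₂ ^ 2 * ((d : ℝ) + 1) * C * Kc) * Real.exp ((δH + δe) * r₂) +
      b₁ * (2 * ((d : ℝ) + 1) * (Real.exp (δe * (r₂ + ℓ + 3)) * Kc)) *
        ((((ℓ : ℝ) + 1)) ^ 2 * (2 * (((ℓ + 1 : ℕ) : ℝ)) ^ (d + 1)) * (A₂ * ((ℓ : ℝ) + 1) * Real.exp (δH * (r₂ + 2 * ℓ + 6))) ^ 2) +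
      ((d : ℝ) + 1) * P₁ * M₁ ^ 2 * ((ℓ : ℝ) + 1) ^ 2 with hBsum
  refine ⟨δe, Real.exp (δe * (r₂ + 1)) + Real.sqrt Bsum, max M₂h M₃, max (max N₁h N₀) (6 * d + 2 * ℓ + 14), hδe0,
    by positivity, lt_max_of_lt_left hM₂h, ?_⟩
  intro m K Mh k R P' hN D hk hk2 a hMha hM8 hR2 hP5 hℓ4 hpl hM hRM cf hcf w hw hwb ν μ y y' ζ J s hs hζ hζs hJ
  -- member facts
  have hMh : 1 ≤ Mh := by omega
  have hP1 : ∀ μ', 1 ≤ P' μ' := fun μ' => (hP5 μ').trans' (by norm_num)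
  have hP4 : ∀ μ', 4 ≤ P' μ' := fun μ' => (hP5 μ').trans' (by norm_num)
  have hk1 : 1 ≤ k := by omega
  have hL2 : 2 * (ℓ + 1) ≤ R := le_trans (Nat.mul_le_mul_left _ (by nlinarith : ℓ + 1 ≤ (ℓ + 1) ^ 2)) hR2
  have hRM2 : 2 ≤ R * Mh := by nlinarith
  have hRM' : 6 * d + 2 * ℓ + 14 + 1 ≤ R * ((ℓ + 1) * Mh) := le_trans (Nat.succ_le_succ (le_max_right _ _)) hRM
  have hRM6 : (d + 2) * 6 < R * ((ℓ + 1) * Mh) - 1 := by omega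
  have hwin : 4 * ((d : ℝ) + 1) + 2 * ℓ + 7 < ((R * ((ℓ + 1) * Mh) - 1 : ℕ) : ℝ) := by
    have h1 : 4 * (d + 1) + 2 * ℓ + 8 ≤ R * ((ℓ + 1) * Mh) - 1 := by omega
    have h2 : ((4 * (d + 1) + 2 * ℓ + 8 : ℕ) : ℝ) ≤ ((R * ((ℓ + 1) * Mh) - 1 : ℕ) : ℝ) := by exact_mod_cast h1
    push_cast at h2
    linarith
  have hN₀R : N₀ + 1 ≤ R * ((ℓ + 1) * Mh) :=
    le_trans (Nat.succ_le_succ ((le_max_right _ _).trans (le_max_left _ _))) hRM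
  have hN₁hR : N₁h + 1 ≤ R * ((ℓ + 1) * Mh) :=
    le_trans (Nat.succ_le_succ ((le_max_left _ _).trans (le_max_left _ _))) hRM
  have hM₂h' : M₂h ≤ ((ℓ : ℝ) + 1) * Mh := (le_max_left _ _).trans hM
  have hM₃' : M₃ ≤ ((ℓ : ℝ) + 1) * Mh := (le_max_right _ _).trans hM
  -- (2.61) at rate `δe` on this member
  have h261 : Ineq261With Kc (geomT D) δe 1 := ineq261_geomT D hMh hP1 hN₀ hN₀R hδe0.le hθ'
  -- (2.88) and (2.140)₂ on this member
  have hSm := hS m K hN D hk hMh hP4 hL2 hM₃' (c := cf) hcf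
  have hlen0 : ∀ z : ↥(bset D.toDomains), 0 ≤ (geomT D).len z := fun z => by
    show 0 ≤ ((ℓ : ℝ) + 1) ^ z.1.1 * 1; positivity
  have hHm : HasL2Majorant (g := geomT D) (blkV1 hN D) (onFun (GE (domT hN D hk) hcf hw) ∘ₗ DVa μ cf)
      (fun y₂ y'' => A₂ * ((geomT D).len y₂ * |cf|⁻¹) * Real.exp (-(δH * (geomT D).dist y₂ y''))) := by
    refine hasL2Majorant_of_sigma (g := geomT D) (blkV1 hN D) (fun y₂ y'' => ?_) (fun y₂ y'' ζ' J' s' hs' hζ' hζs' hJ' => ?_)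
    · exact mul_nonneg (mul_nonneg hA₂ (mul_nonneg (hlen0 y₂) (inv_nonneg.2 (abs_nonneg _)))) (Real.exp_pos _).le
    · exact hH m K hN D hk hk2 hMha hM8 hR2 hP5 hℓ4 hpl hM₂h' hN₁hR hcf hw hwb μ y₂ y'' ζ' J' hs' hζ' hζs' hJ'
  -- the per-member bound and the printed Σ-shape
  have hmem : HasL2Majorant (g := geomT D) (blkV1 hN D) (DV ν cf ∘ₗ onFun (GE (domT hN D hk) hcf hw) ∘ₗ DVa μ cf)
      (fun y₁ y₂ => (Real.exp (δe * (r₂ + 1)) + Real.sqrt Bsum) * Real.exp (-(δe * (geomT D).dist y₁ y₂))) := by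
    intro y₁ y₂ u hu
    have h := l2n_blockPiece_DGDa_le hN D hk hMh hP1 hk1 hRM2 hRM6 hwin h261 hδe0.le hwb hcf hw (hb₀.le.trans hb₁) hC.le
      hδe0.le hδeP hSm hA₂ hδeH μ hHm ν y₁ y₂ u hu
    rw [hBsum, hP₁, hM₁, hr₂]
    exact h
  exact sum_sq_cut_apply_le_of_hasL2Majorant (blkV1 hN D) hmem y y' ζ J hs hζ hζs hJ

end Literature.MathematicalPhysics.QuantumFieldTheory.Balaban1983to89.B6Ineq2140GradGDivCensusKLevelV1
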